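import Literature.Combinatorics.Hinz2018.HanoiGraphsHpInvariants
import HarnessLib

/-!
# The peg-pair edge colouring of the Hanoi graphs `H_p^n` (Hinz–Parisse 2012, Lemma 1):
# `χ′(H_p^n) ≤ C(p,2)`, hence Theorem 5.50 `χ′(H_p^n) = Δ(H_p^n)` for `3 ≤ p ≤ n + 1`
# (the named fact `ChromaticIndexHanoi p n` for `p ≤ n + 3`)

Sources. A. M. Hinz, S. Klavžar, C. Petr, *The Tower of Hanoi – Myths and Maths* (2nd ed., 2018)
[`HinzKlavzarPetr2018`], Ch. 5 §5.6, Theorem 5.50 (Hinz–Parisse [211]): «For any p ∈ ℕ₃ and any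
n ∈ ℕ₂, χ′(H_p^n) = Δ(H_p^n).» — recorded in the tree file `HanoiGraphsHpInvariants` as the NAMED
FACT `ChromaticIndexHanoi p n : Prop` (`χ′(H_p^{n+2}) = Δ(H_p^{n+2})`, `χ′` = chromatic number of the
line graph), proved there for `p = 3` only. A. M. Hinz, D. Parisse, *Coloring Hanoi and Sierpiński
graphs*, Discrete Math. 312 (2012) 1521–1535 [`HinzParisse2012`; held text
`paper:doi-10-1016-j-disc-2011-08-019`, locators `pNNNN` = its chunks], §3.1 (p0010): «As it is clear
that χ′(G) ≥ Δ(G) for any graph, we will prove our theorem by providing appropriate Δ(G)-colorings in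
five steps» (Lemmas 1–5; the displayed statements are lost in the held OCR) and §3.2 (p0011): «Proof
of Lemma 1. Let us color the edges of H_p^n according to the (unordered) pair of pegs involved in the
corresponding move of a disc.»

## What is formalised

* The PEG-PAIR COLOURING (proof of Lemma 1): the edge `{s, t}` of `H_p^m` receives the unordered pair
  of pegs `{s_d, t_d}` of the moved disc `d` (`movePegs`, `pegPairLabel`), a `2`-subset of the `p`
  pegs; it is a proper edge colouring (`pegPairColoring`): between two pegs at most one move is legal
  at a given state (the smaller of the two top discs moves), so two distinct moves at a state involve
  distinct peg pairs (`movePegs_ne_of_adj_of_adj`). Hence `χ′(H_p^m) ≤ C(p, 2)`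
  (`hanoiGraphP_lineGraph_colorable_choose`, `hanoiGraphP_chromaticIndex_le_choose`).
* With Proposition 5.44 of the book (tree: `proposition_5_44_maxDegree_of_le`, `Δ(H_p^m) = C(p,2)`
  for `m ≥ p − 1`) this gives **Theorem 5.50 in the range `p ≤ n + 3`**:
  `chromaticIndexHanoi_of_le_add_three (h : p ≤ n + 3) : ChromaticIndexHanoi p n` (the degenerate
  `p ≤ 2` included). For `p ≥ n + 4` one has `Δ(H_p^{n+2}) < C(p,2)` and the peg-pair colouring is not
  optimal; that range is Hinz–Parisse's Lemmas 2–3 (recursive `K_p`-factorisations), NOT formalised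
  here — the named fact stays open there and is NOT asserted.

Everything below is proved; the three `def`s are the explicit colouring; no named fact, no `sorry`.
-/

namespace Literature.Combinatorics.Hinz2018

open Finset

section PegPairColouring

variable {p m : ℕ}

/-- The pegs involved in the move `s → t`: the union of `{s_d, t_d}` over the discs `d` that change
peg (for a legal move, exactly one disc). [cite: HinzParisse2012, §3.2 proof of Lemma 1 («the (unordered) pair of pegs involved in the corresponding move of a disc»), p0011] -/
def movePegs (s t : Fin m → Fin p) : Finset (Fin p) :=
  (univ.filter fun d => s d ≠ t d).biUnion fun d => {s d, t d}

/-- The pair of pegs of a move does not depend on its direction.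
[cite: HinzParisse2012, §3.2 proof of Lemma 1, p0011] -/
theorem movePegs_comm (s t : Fin m → Fin p) : movePegs s t = movePegs t s := by
  unfold movePegs
  have h : (univ.filter fun d => s d ≠ t d) = univ.filter fun d => t d ≠ s d :=
    filter_congr fun d _ => ne_comm
  rw [h]
  exact biUnion_congr rfl fun d _ => pair_comm _ _

/-- For a legal move of disc `d` from peg `s_d` to peg `t_d`: `movePegs s t = {s_d, t_d}`, together
with the legality data of the move. [cite: HinzParisse2012, §3.2 proof of Lemma 1, p0011] -/
theorem exists_movePegs_eq_pair {s t : Fin m → Fin p} (h : (hanoiGraphP p m).Adj s t) :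
    ∃ d : Fin m, s d ≠ t d ∧ (∀ e, e ≠ d → t e = s e) ∧ (∀ e, e < d → s e ≠ s d ∧ s e ≠ t d) ∧
      movePegs s t = {s d, t d} := by
  obtain ⟨d, hne, hoff, hsm⟩ := h
  refine ⟨d, hne, hoff, hsm, ?_⟩
  have hf : (univ.filter fun e => s e ≠ t e) = {d} := by
    ext e
    simp only [mem_filter, mem_univ, true_and, mem_singleton]
    constructor
    · intro he
      by_contra hed
      exact he (hoff e hed).symm
    · rintro rfl
      exact hne
  unfold movePegs
  rw [hf, singleton_biUnion]

/-- **At a state, distinct legal moves involve distinct pairs of pegs** (between two pegs only the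
smaller of the two top discs can move): the peg-pair labelling separates adjacent edges.
[cite: HinzParisse2012, §3.2 proof of Lemma 1, p0011] -/
theorem movePegs_ne_of_adj_of_adj {v w₁ w₂ : Fin m → Fin p} (h₁ : (hanoiGraphP p m).Adj v w₁)
    (h₂ : (hanoiGraphP p m).Adj v w₂) (hw : w₁ ≠ w₂) : movePegs v w₁ ≠ movePegs v w₂ := by
  obtain ⟨d₁, hne₁, hoff₁, hsm₁, h1⟩ := exists_movePegs_eq_pair h₁
  obtain ⟨d₂, hne₂, hoff₂, hsm₂, h2⟩ := exists_movePegs_eq_pair h₂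
  rw [h1, h2]
  intro H
  rcases lt_trichotomy d₁ d₂ with hlt | rfl | hgt
  · have hmem : v d₁ ∈ ({v d₂, w₂ d₂} : Finset (Fin p)) := by
      rw [← H]; exact mem_insert_self _ _
    rw [mem_insert, mem_singleton] at hmem
    rcases hmem with h | h
    · exact (hsm₂ d₁ hlt).1 h
    · exact (hsm₂ d₁ hlt).2 h
  · have hmem : w₁ d₁ ∈ ({v d₁, w₂ d₁} : Finset (Fin p)) := by
      rw [← H]; exact mem_insert_of_mem (mem_singleton_self _)
    rw [mem_insert, mem_singleton] at hmem
    rcases hmem with h | h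
    · exact hne₁ h.symm
    · apply hw
      funext e
      by_cases hed : e = d₁
      · rw [hed, h]
      · rw [hoff₁ e hed, hoff₂ e hed]
  · have hmem : v d₂ ∈ ({v d₁, w₁ d₁} : Finset (Fin p)) := by
      rw [H]; exact mem_insert_self _ _
    rw [mem_insert, mem_singleton] at hmem
    rcases hmem with h | h
    · exact (hsm₁ d₂ hgt).1 h
    · exact (hsm₁ d₂ hgt).2 h

/-- The peg-pair label on unordered pairs of states.
[cite: HinzParisse2012, §3.2 proof of Lemma 1, p0011] -/
def pegPairLabel (p m : ℕ) : Sym2 (Fin m → Fin p) → Finset (Fin p) :=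
  Sym2.lift ⟨movePegs, movePegs_comm⟩

/-- `pegPairLabel p m s(s, t) = movePegs s t`. [cite: HinzParisse2012, §3.2 proof of Lemma 1, p0011] -/
theorem pegPairLabel_mk (s t : Fin m → Fin p) : pegPairLabel p m s(s, t) = movePegs s t := rfl

/-- On an edge of `H_p^m` the label is a `2`-subset of the pegs.
[cite: HinzParisse2012, §3.2 proof of Lemma 1, p0011] -/
theorem pegPairLabel_mem_powersetCard {e : Sym2 (Fin m → Fin p)} (he : e ∈ (hanoiGraphP p m).edgeSet) :
    pegPairLabel p m e ∈ (univ : Finset (Fin p)).powersetCard 2 := by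
  induction e using Sym2.ind with
  | h s t =>
    rw [SimpleGraph.mem_edgeSet] at he
    obtain ⟨d, hne, -, -, hd⟩ := exists_movePegs_eq_pair he
    rw [pegPairLabel_mk, hd, mem_powersetCard]
    exact ⟨subset_univ _, card_pair hne⟩

/-- **THE PEG-PAIR COLOURING IS PROPER** (Hinz–Parisse, proof of Lemma 1): colouring each edge of
`H_p^m` by the unordered pair of pegs of its move is a proper edge colouring with the `C(p,2)` pairs
of pegs as colours (a `Coloring` of the line graph by the `2`-subsets of `Fin p`).
[cite: HinzParisse2012, §3.1 (Lemma 1, one of the «five steps»), p0010; §3.2 proof of Lemma 1, p0011] -/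
def pegPairColoring (p m : ℕ) :
    (hanoiGraphP p m).lineGraph.Coloring ↥((univ : Finset (Fin p)).powersetCard 2) :=
  SimpleGraph.Coloring.mk (fun e => ⟨pegPairLabel p m e.val, pegPairLabel_mem_powersetCard e.prop⟩)
    fun {e₁ e₂} h => by
    obtain ⟨hne, v, hv₁, hv₂⟩ := SimpleGraph.lineGraph_adj_iff_exists.mp h
    have h₁ := Sym2.other_spec hv₁
    have h₂ := Sym2.other_spec hv₂
    have a₁ : (hanoiGraphP p m).Adj v (Sym2.Mem.other hv₁) := by
      rw [← SimpleGraph.mem_edgeSet, h₁]; exact e₁.prop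
    have a₂ : (hanoiGraphP p m).Adj v (Sym2.Mem.other hv₂) := by
      rw [← SimpleGraph.mem_edgeSet, h₂]; exact e₂.prop
    have hw : Sym2.Mem.other hv₁ ≠ Sym2.Mem.other hv₂ := fun H =>
      hne (Subtype.ext (by
        calc e₁.val = s(v, Sym2.Mem.other hv₁) := h₁.symm
          _ = s(v, Sym2.Mem.other hv₂) := by rw [H]
          _ = e₂.val := h₂))
    intro H
    have H' : pegPairLabel p m e₁.val = pegPairLabel p m e₂.val := congrArg Subtype.val H
    rw [← h₁, ← h₂, pegPairLabel_mk, pegPairLabel_mk] at H'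
    exact movePegs_ne_of_adj_of_adj a₁ a₂ hw H'

/-- **Lemma 1 of Hinz–Parisse**: the line graph of `H_p^m` is `C(p,2)`-colourable.
[cite: HinzParisse2012, §3.1 (Lemma 1), p0010; §3.2 proof of Lemma 1, p0011] -/
theorem hanoiGraphP_lineGraph_colorable_choose (p m : ℕ) :
    (hanoiGraphP p m).lineGraph.Colorable (p.choose 2) := by
  have h := (pegPairColoring p m).colorable
  rwa [Fintype.card_coe, card_powersetCard, card_univ, Fintype.card_fin] at h

/-- `χ′(H_p^m) ≤ C(p,2)`. [cite: HinzParisse2012, §3.1 (Lemma 1), p0010; §3.2 proof of Lemma 1, p0011] -/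
theorem hanoiGraphP_chromaticIndex_le_choose (p m : ℕ) :
    (hanoiGraphP p m).lineGraph.chromaticNumber ≤ (p.choose 2 : ℕ) :=
  (hanoiGraphP_lineGraph_colorable_choose p m).chromaticNumber_le

/-- **Theorem 5.50 for `p ≤ n + 3`** (i.e. `χ′(H_p^{n+2}) = Δ(H_p^{n+2})` whenever the number `n + 2`
of discs is at least `p − 1`): then `Δ(H_p^{n+2}) = C(p,2)` (Proposition 5.44) is attained by the
peg-pair colouring. The named fact `ChromaticIndexHanoi p n` in this range (degenerate `p ≤ 2`
included); the range `p ≥ n + 4` (Hinz–Parisse Lemmas 2–3) is not covered here.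
[cite: HinzKlavzarPetr2018, Ch. 5 §5.6 Thm. 5.50, p. 263 (Hinz–Parisse, ref. 211); Prop. 5.44, p. 259; HinzParisse2012, §3.1–§3.2 (Lemma 1), p0010–p0011] -/
theorem chromaticIndexHanoi_of_le_add_three {p n : ℕ} (h : p ≤ n + 3) : ChromaticIndexHanoi p n := by
  rw [chromaticIndexHanoi_iff]
  rcases Nat.eq_zero_or_pos p with rfl | hp
  · have h0 := hanoiGraphP_lineGraph_colorable_choose 0 (n + 2)
    rw [Nat.choose_zero_succ] at h0
    exact h0.mono (Nat.zero_le _)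
  · rw [proposition_5_44_maxDegree_of_le hp (by omega)]
    exact hanoiGraphP_lineGraph_colorable_choose p (n + 2)

/-- In particular Theorem 5.50 for every `p` once there are enough discs: `χ′(H_p^{m}) = Δ(H_p^{m})`
for all `m ≥ max(2, p − 1)`, here as `ChromaticIndexHanoi p (n + p)` for all `p, n`.
[cite: HinzKlavzarPetr2018, Ch. 5 §5.6 Thm. 5.50, p. 263 (Hinz–Parisse, ref. 211); HinzParisse2012, §3.1–§3.2 (Lemma 1), p0010–p0011] -/
theorem chromaticIndexHanoi_add (p n : ℕ) : ChromaticIndexHanoi p (n + p) :=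
  chromaticIndexHanoi_of_le_add_three (by omega)

end PegPairColouring

end Literature.Combinatorics.Hinz2018
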